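/-
Copyright: lit-balaban Phase-2 proof seat p02 (gen 8).  Statement-level skeleton of a published paper; no proof claims beyond what
the kernel checks below.
-/
import Literature.MathematicalPhysics.QuantumFieldTheory.BalabanImbrieJaffe1984to88.BIJ88CkLoc226Torus
import Literature.MathematicalPhysics.QuantumFieldTheory.BalabanImbrieJaffe1984to88.BIJ88Sect5StatementsPart2

/-!
# `BalabanImbrieJaffe1984to88.BIJ88Ineq547W2Torus` — T. Bałaban, J. Imbrie, A. Jaffe, *Effective action and cluster properties of the
abelian Higgs model*, Commun. Math. Phys. **114** (1988) 257–315 [BalabanImbrieJaffe1988], §5.4 *Gauge Transformation*, p. 282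
**(5.4.7)** — the small phase kernel `w₂ = Λ̄₃^{(k)}C_{k,loc} − Λ̄₃^{(k)}C_k□` and its bound *"|w₂(x,b)| ≦ exp(−cr(e_k))exp(−c dist(x,b))"*,
p. 283 *"[this follows from (2.26)]"* — PROVED ON THE TORI OF THE SERIES FOR THE `C_k`, `C_{k,loc}` OF RECORD (seat p08's
`BIJ88Eq220Torus.CkE` = (2.22) verbatim, `C_{k,loc} = ζ′_kC_k` (2.25) with p13's (2.24) cutoff), given only [6I] Proposition 1.2 by
its tree name: r16's typed shape `BIJ88Sect5StatementsPart2.Ineq547` is INHABITED by the torus kernel, with ONE decay constant and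
ONE radius threshold for every scale `k ≤ m + K`

statement-level skeleton of published theorems with citation tags; proofs where landed; nothing here is a claim about the Yang–Mills mass gap

PDF held: `paper:balaban1988-cmp114-bij-abelian-higgs-effective-action` (journal page = PDF page + 256); p. 282 [PDF 26] read this
session as the render `HOME/lit-balaban-r16/renders/cmp114/original-p026-x2.png`, p. 283 [PDF 27] from the text layer
(`~/.lit/texts/paper-balaban1988-cmp114-bij-abelian-higgs-effective-action/p0027.txt`).

CITATION HEADER (lean-in-tree rule).  Part of the lit-balaban TYPED SKELETON (HOME `run/shared/lean/pub/lit-balaban/`), Phase-2 proof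
seat p02 (gen 8), unit `lit-balaban-p02`; WHAT IS REPRODUCED = SKELETON row **C2.Eq5.4.7** (reader file `HOME/lit-balaban-r16/ROWS-C2-part2.md`,
owner r16, referee ref-5: *"typed p240155 (Prop leaf, schematic carriers) · w₂ def `w2` typed p243601 · (5.4.7) for w₂ proved p247855
(p36, model instance: `BIJ88Ineq547Proof.ineq547_matrix` … ) · head unchanged"*), kind «model instance FOR THE KERNELS OF RECORD ON
THE TORI»: the p36 matrix instance (one abstract index type, (2.26) a displayed hypothesis) is here replaced by the torus kernels with
(2.26) DISCHARGED down to [6I] Proposition 1.2 (`B5.Prop12Printed`, row B5.Prop1.2 — proved for the tori of record by p37 p302056;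
the bridge to the `levStd` torus family used here is the announced target of p19/p30, HOME/STATUS 20:23Z/20:25Z).  TAKING line
HOME/STATUS.md 2026-08-21T21:09:53Z.  Decls used BY NAME (nothing restated): r16's `Ineq547`, r18's `Close`/`loc`, p13's
`BIJ88Cutoffs21.cutoff`, p08's `BIJ88Eq220Torus.CkE` and `BIJ88CkLoc226Torus.close226_torus_prop12`.

THE PRINTED TEXT (p. 282 [PDF 26], verbatim): *"After these rotations, the scalar field still have small, term-dependent phase factors.
The scalar fields appear as φ(x)exp[ie_k(w₂A′)(x)], ψ(y)exp[ie_k(w₂A′)(y)], where w₂ = Λ̄₃^{(k)}C_{k,loc} − Λ̄₃^{(k)}C_k□ satisfies a bound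
|w₂(x,b)| ≦ exp(−cr(e_k))exp(−c dist(x,b)), (5.4.7)"*; p. 283 l. 1: *"[this follows from (2.26)]"*; (2.26) p. 262: *"|C_{k,loc}(x,b′) −
C_k(x,b′)| ≦ e^{−cr(e_k)}e^{−c dist(x,b′)}"*.

THE TORUS DATA (all in the tree, as in `BIJ88CkLoc226Torus`): fine sites `x ∈ T_η = TSite P 0`, unit bonds `b ∈ T₁^{(k)*} = PBond P k`,
`C_k(x,b) := (CkE P hd η_k^d L^k k e_b)(x)`, `dist(x,b) := distEU P k x b₋`, `ζ′_k := cutoff (r/4) (r/2) dist` at the radius parameter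
`r` (print: `r = r(e_k)`), `C_{k,loc} := loc ζ′_k C_k` (2.25); the region `Λ̄₃^{(k)}` enters as a contraction `χ₃ : TSite P 0 → ℝ`,
`|χ₃| ≤ 1` (a characteristic function), and the term-dependent cube `□` as a family `χ□ : PBond P k → PBond P k → ℝ` read
COLUMN-WISE, `χ□ b b = 1` — exactly p36's reading of *"□ is centered near the plaquette that we are evaluating … at"* (a FIXED cube
makes (5.4.7) false off `□`, where `w₂(x,b) = Λ̄₃(x)C_{k,loc}(x,b)` is `O(1)`; recorded in `BIJ88Ineq547Proof`).

WHAT IS PROVED (0 `sorry`, standard axioms; theorems only — proof lane):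
* §1 MECHANISM (any carriers): `w2_entry_col` (at `χ□(b) = 1` the entry is `χ₃(x)(C_{k,loc} − C_k)(x,b)`), **`ineq547_of_close`** — a
  (2.26)-type closeness `|C_{k,loc} − C_k| ≤ εe^{−δdist}` with `ε ≤ e^{−cr}` and `c ≤ δ` gives r16's `Ineq547 … w₂ dist c r` for
  every contraction `|χ₃| ≤ 1` and every column-wise cube family; `le_exp_of_le_mul` / `prefactor_absorb` (the arithmetic of
  *"r(e_k) large"*: `c₀ ≤ γr ⇒ c₀e^{−2γr} ≤ e^{−γr}`).
* §2 ON THE TORI, GIVEN ONLY `B5.Prop12Printed` (`levStd` family): **`ineq547_w2_torus`** — `∃ c > 0, ∃ r₁, ∀ k ≤ m + K, ∀ r ≥ r₁,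
  ∀ χ₃ (|χ₃| ≤ 1), ∀ χ□ (χ□ b b = 1): Ineq547 (TSite P 0) (PBond P k) w₂ dist c r` for the torus kernel
  `w₂(x,b) = χ₃(x)C_{k,loc}(x,b) − χ₃(x)C_k(x,b)χ□_b(b)`, from p08's (2.26) `close226_torus_prop12` (`c = δ′/16`, `r₁ = max(4R₀, 16c₀/δ′)`
  in that theorem's constants); `ineq547_w2_torus_diff` (the same for the bare difference kernel `χ₃(C_{k,loc} − C_k)`).
HONEST SCOPE.  (i) The one remaining hypothesis is [6I] Proposition 1.2 BY NAME for the `levStd` torus family (as in every p08 torus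
file of C2 §2); constants existential per torus `P`, uniform in `k ≤ m + K` and in the radius `r ≥ r₁`.  (ii) `r` is a free parameter
(print: `r = r(e_k)` large for `e_k` small — the threshold `r ≥ r₁` is that largeness); `□` column-wise as in the model instance of record.
(iii) `U = 1` background as in p08's `CkE` files, real abelian fields, torus, standing range.  (iv) The *"similarly"* kernels `w′₁`,
`∂w′₁`, `∂*w′₁`, `w₁` of p. 282 (multi-scale, through (2.12)) are NOT treated here (p08 g4 `BIJ88Ineq547W1Prime`, matrix instances).
(v) No `def`, no new named fact, nothing restated; NOT summit progress; NOT a claim about any continuum limit.  Unit `lit-balaban-p02`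
(literature-prover-lit-balaban-p02-g8-0), 2026-08-21.
-/

open scoped BigOperators RealInnerProductSpace

namespace Literature.MathematicalPhysics.QuantumFieldTheory.BalabanImbrieJaffe1984to88.BIJ88Ineq547W2Torus

open Balaban1983to89 hiding Site Plaq
open Balaban1983to89.LatticeFieldCalculus
open BIJ85AxialPropagator411 BIJ85Prop521Torus BIJ85Sigma421Torus BIJ85Prop522Torus BIJ85Sigma422Eta
open BIJ85Sect7Statements BIJ85Ineq722Torus
open BIJ85Ineq722DeltaA (deltaAData)
open BIJ85Ineq722ProofPart2 (settingOf)
open BIJ88Sect2Statements (Close loc)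
open BIJ88Sect5StatementsPart2 (Ineq547)
open BIJ88Cutoffs21 (cutoff)
open BIJ88Eq220Torus (CkE)
open BIJ88CkLoc226Torus (close226_torus_prop12)

open Balaban1983to89 renaming Site → TSite, Plaq → TPlaq

noncomputable section

variable {P : Params}

/-! ## §1  The mechanism: (2.26)-closeness ⟹ (5.4.7), prefactor absorbed for `r(e_k)` large -/

section Mechanism

variable {α β : Type}

/-- the entry of `w₂ = Λ̄₃C_{k,loc} − Λ̄₃C_k□` at a bond of the cube (`χ□(b) = 1`, the column-wise reading): `w₂(x,b) =
χ₃(x)·(C_{k,loc}(x,b) − C_k(x,b))` — a contraction of the (2.26) difference. [cite: BalabanImbrieJaffe1988, (5.4.7) p.282] -/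
theorem w2_entry_col (χ₃ : α → ℝ) (Cloc Ck : α → β → ℝ) {χb : β → ℝ} {b : β} (hb : χb b = 1) (x : α) :
    χ₃ x * Cloc x b - χ₃ x * Ck x b * χb b = χ₃ x * (Cloc x b - Ck x b) := by
  rw [hb, mul_one, mul_sub]

/-- **(5.4.7) from (2.26)**, the printed *"[this follows from (2.26)]"*: if `|C_{k,loc}(x,b) − C_k(x,b)| ≤ εe^{−δdist(x,b)}` for all
`x, b` (a `Close dist C_{k,loc} C_k ε δ`), `ε ≤ e^{−cr}`, `c ≤ δ` and `dist ≥ 0`, then for every contraction `|χ₃| ≤ 1` and every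
column-wise cube family `χ□` (`χ□_b(b) = 1`) the kernel `w₂(x,b) = χ₃(x)C_{k,loc}(x,b) − χ₃(x)C_k(x,b)χ□_b(b)` satisfies r16's
`Ineq547 … w₂ dist c r`: `|w₂(x,b)| ≤ e^{−cr}e^{−c·dist(x,b)}`. [cite: BalabanImbrieJaffe1988, (5.4.7) p.282] -/
theorem ineq547_of_close {dist : α → β → ℝ} (hdist : ∀ x b, 0 ≤ dist x b) {Cloc Ck : α → β → ℝ} {ε δ c r : ℝ}
    (hclose : Close dist Cloc Ck ε δ) (hε : ε ≤ Real.exp (-(c * r))) (hcδ : c ≤ δ)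
    {χ₃ : α → ℝ} (hχ₃ : ∀ x, |χ₃ x| ≤ 1) {χb : β → β → ℝ} (hχb : ∀ b, χb b b = 1) :
    Ineq547 α β (fun x b => χ₃ x * Cloc x b - χ₃ x * Ck x b * χb b b) dist c r := by
  intro x b
  show |χ₃ x * Cloc x b - χ₃ x * Ck x b * χb b b| ≤ _
  rw [w2_entry_col χ₃ Cloc Ck (hχb b) x, abs_mul]
  have h1 : |χ₃ x| * |Cloc x b - Ck x b| ≤ 1 * (ε * Real.exp (-δ * dist x b)) :=
    mul_le_mul (hχ₃ x) (hclose x b) (abs_nonneg _) zero_le_one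
  rw [one_mul] at h1
  refine h1.trans ?_
  have e2 : Real.exp (-δ * dist x b) ≤ Real.exp (-(c * dist x b)) := by
    rw [neg_mul]
    exact Real.exp_le_exp.mpr (neg_le_neg (mul_le_mul_of_nonneg_right hcδ (hdist x b)))
  exact mul_le_mul hε e2 (Real.exp_pos _).le (Real.exp_pos _).le

/-- the same for the bare restricted difference `χ₃(x)(C_{k,loc} − C_k)(x,b)` (no cube factor). [cite: BalabanImbrieJaffe1988, (5.4.7) p.282] -/
theorem ineq547_of_close_diff {dist : α → β → ℝ} (hdist : ∀ x b, 0 ≤ dist x b) {Cloc Ck : α → β → ℝ} {ε δ c r : ℝ}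
    (hclose : Close dist Cloc Ck ε δ) (hε : ε ≤ Real.exp (-(c * r))) (hcδ : c ≤ δ)
    {χ₃ : α → ℝ} (hχ₃ : ∀ x, |χ₃ x| ≤ 1) :
    Ineq547 α β (fun x b => χ₃ x * (Cloc x b - Ck x b)) dist c r := by
  intro x b
  have h := ineq547_of_close hdist hclose hε hcδ hχ₃ (χb := fun _ _ => (1 : ℝ)) (fun _ => rfl) x b
  simpa only [mul_one, ← mul_sub] using h

/-- the arithmetic of *"r(e_k) large"*, step 1: `c₀ ≤ γr ⇒ c₀ ≤ e^{γr}` (`1 + y ≤ e^y`). [folklore] -/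
private theorem le_exp_of_le_mul {c₀ γ r : ℝ} (h : c₀ ≤ γ * r) : c₀ ≤ Real.exp (γ * r) :=
  h.trans ((le_add_of_nonneg_right zero_le_one).trans (by simpa [add_comm] using Real.add_one_le_exp (γ * r)))

/-- the arithmetic of *"r(e_k) large"*, step 2: if `c₀ ≤ e^{γr}` then the (2.26) prefactor `c₀e^{−2γ·r}` is `≤ e^{−γr}` — one power
of the small factor absorbs the constant. [folklore] -/
private theorem prefactor_absorb {c₀ γ r : ℝ} (h : c₀ ≤ Real.exp (γ * r)) :
    c₀ * Real.exp (-(2 * γ) * r) ≤ Real.exp (-(γ * r)) := by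
  have hpos : 0 < Real.exp (-(2 * γ) * r) := Real.exp_pos _
  calc c₀ * Real.exp (-(2 * γ) * r) ≤ Real.exp (γ * r) * Real.exp (-(2 * γ) * r) :=
        mul_le_mul_of_nonneg_right h hpos.le
    _ = Real.exp (-(γ * r)) := by rw [← Real.exp_add]; congr 1; ring

end Mechanism

/-! ## §2  (5.4.7) on the tori for the `C_k`, `C_{k,loc}` of record, given only [6I] Proposition 1.2 -/

/-- `distEU ≥ 0` (a cast natural number over a positive power). [folklore] -/
private theorem distEU_nonneg' (k : ℕ) (x : TSite P 0) (y : TSite P k) : 0 ≤ distEU P k x y := by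
  unfold distEU
  exact div_nonneg (Nat.cast_nonneg _) (pow_nonneg (Nat.cast_nonneg _) _)

/-- **(5.4.7) ON THE TORI FOR THE KERNELS OF RECORD, GIVEN ONLY [6I] PROPOSITION 1.2 BY ITS TREE NAME**: there are `c > 0` and a
radius threshold `r₁` such that for EVERY scale `k ≤ m + K`, every radius `r ≥ r₁` (print: `r = r(e_k)` large), every contraction
`χ₃` of the fine sites with `|χ₃| ≤ 1` (the characteristic function of `Λ̄₃^{(k)}`) and every column-wise cube family `χ□`
(`χ□_b(b) = 1`), the kernel `w₂(x,b) = χ₃(x)C_{k,loc}(x,b) − χ₃(x)C_k(x,b)χ□_b(b)` — `C_k = CkE P hd η_k^d L^k k`, `C_{k,loc} = ζ′_kC_k`,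
`ζ′_k = cutoff (r/4) (r/2) dist` — satisfies r16's typed **`Ineq547 (TSite P 0) (PBond P k) w₂ dist c r`**, i.e.
`|w₂(x,b)| ≤ e^{−cr}e^{−c·dist(x,b)}` with `dist(x,b) = distEU P k x b₋`; `c = δ′/16` and `r₁ = max(4R₀, 16c₀/δ′)` in the constants of
p08's (2.26) `close226_torus_prop12` — the printed *"[this follows from (2.26)]"*. [cite: BalabanImbrieJaffe1988, (5.4.7) p.282] -/
theorem ineq547_w2_torus (hd : 2 ≤ P.d) {a : ℝ} (ha : 0 < a)
    (h12 : B5.Prop12Printed (fun i => settingOf (torusRep P (levStd P i) (deltaAData (levStd_le i) a)) i)) :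
    ∃ c r₁ : ℝ, 0 < c ∧ ∀ (k : ℕ) (hk : k ≤ P.m + P.K) (r : ℝ), r₁ ≤ r →
      ∀ (χ₃ : TSite P 0 → ℝ), (∀ x, |χ₃ x| ≤ 1) → ∀ (χb : PBond P k → PBond P k → ℝ), (∀ b, χb b b = 1) →
        Ineq547 (TSite P 0) (PBond P k)
          (fun x b =>
            χ₃ x * loc (cutoff (r / 4) (r / 2) fun (x : TSite P 0) (b' : PBond P k) => distEU P k x b'.src)
                (fun x b' => CkE P hd ((P.eta k) ^ P.d) ((P.L : ℝ) ^ k) k (toEj P k (Pi.single b' 1)) x) x b -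
              χ₃ x * CkE P hd ((P.eta k) ^ P.d) ((P.L : ℝ) ^ k) k (toEj P k (Pi.single b 1)) x * χb b b)
          (fun x b => distEU P k x b.src) c r := by
  obtain ⟨R₀, c₀, δ', hδ', hc₀, h226⟩ := close226_torus_prop12 hd ha h12
  refine ⟨δ' / 16, max (4 * R₀) (16 * c₀ / δ'), by positivity, fun k hk r hr χ₃ hχ₃ χb hχb => ?_⟩
  have hr4 : 4 * R₀ ≤ r := (le_max_left _ _).trans hr
  have hr16 : 16 * c₀ / δ' ≤ r := (le_max_right _ _).trans hr
  have hclose := h226 k hk r hr4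
  -- the prefactor of (2.26): c₀e^{−(δ′/2)(r/4)} = c₀e^{−2(δ′/16)r} ≤ e^{−(δ′/16)r} once 16c₀/δ′ ≤ r
  have hc₀r : c₀ ≤ δ' / 16 * r := by
    have h16 : (0 : ℝ) < 16 := by norm_num
    rw [div_le_iff₀ hδ'] at hr16
    nlinarith
  have hε : c₀ * Real.exp (-(δ' / 2) * (r / 4)) ≤ Real.exp (-(δ' / 16 * r)) := by
    have h := prefactor_absorb (le_exp_of_le_mul hc₀r)
    have e : -(2 * (δ' / 16)) * r = -(δ' / 2) * (r / 4) := by ring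
    rwa [e] at h
  have hcδ : δ' / 16 ≤ δ' / 2 := by linarith
  have key := ineq547_of_close (α := TSite P 0) (β := PBond P k) (dist := fun x b => distEU P k x b.src)
    (Cloc := loc (cutoff (r / 4) (r / 2) fun (x : TSite P 0) (b' : PBond P k) => distEU P k x b'.src)
      (fun x b' => CkE P hd ((P.eta k) ^ P.d) ((P.L : ℝ) ^ k) k (toEj P k (Pi.single b' 1)) x))
    (Ck := fun x b' => CkE P hd ((P.eta k) ^ P.d) ((P.L : ℝ) ^ k) k (toEj P k (Pi.single b' 1)) x)
    (fun x b => distEU_nonneg' k x b.src) hclose hε hcδ hχ₃ hχb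
  intro x b
  exact key x b

/-- **(5.4.7) on the tori for the bare restricted difference** `χ₃(x)(C_{k,loc} − C_k)(x,b)` (the entry at `b ∈ □`): same constants.
[cite: BalabanImbrieJaffe1988, (5.4.7) p.282] -/
theorem ineq547_w2_torus_diff (hd : 2 ≤ P.d) {a : ℝ} (ha : 0 < a)
    (h12 : B5.Prop12Printed (fun i => settingOf (torusRep P (levStd P i) (deltaAData (levStd_le i) a)) i)) :
    ∃ c r₁ : ℝ, 0 < c ∧ ∀ (k : ℕ) (hk : k ≤ P.m + P.K) (r : ℝ), r₁ ≤ r →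
      ∀ (χ₃ : TSite P 0 → ℝ), (∀ x, |χ₃ x| ≤ 1) →
        Ineq547 (TSite P 0) (PBond P k)
          (fun x b =>
            χ₃ x * (loc (cutoff (r / 4) (r / 2) fun (x : TSite P 0) (b' : PBond P k) => distEU P k x b'.src)
                (fun x b' => CkE P hd ((P.eta k) ^ P.d) ((P.L : ℝ) ^ k) k (toEj P k (Pi.single b' 1)) x) x b -
              CkE P hd ((P.eta k) ^ P.d) ((P.L : ℝ) ^ k) k (toEj P k (Pi.single b 1)) x))
          (fun x b => distEU P k x b.src) c r := by
  obtain ⟨c, r₁, hc, h⟩ := ineq547_w2_torus hd ha h12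
  refine ⟨c, r₁, hc, fun k hk r hr χ₃ hχ₃ x b => ?_⟩
  have h' := h k hk r hr χ₃ hχ₃ (fun _ _ => (1 : ℝ)) (fun _ => rfl) x b
  simpa only [mul_one, ← mul_sub] using h'

end

end Literature.MathematicalPhysics.QuantumFieldTheory.BalabanImbrieJaffe1984to88.BIJ88Ineq547W2Torus
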